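import Mathlib
import Literature.Computability.AlgebraicComplexity.NewtonPolygonTauProductBounds
import Summits.ValiantsHypothesis.ValiantsHypothesis.Theorems.NewtonUnitEquationsDissociatedUniformTotalsLawStaircasePattern
import HarnessLib

/-!
# Crux `NewtonUnitEquations.DissociatedUniform` (stmt-ValiantsHypothesis-5905), `n = 3` totals law of model (Q**):
# the STAIRCASE HULL BOUND — `#vert conv {v_i + b_j : pos i < pos j} ≤ 4·(#rows + #columns)`

A planar Minkowski sum `A + B` has at most `#A + #B` hull vertices.  This file proves the analogue for the HALF-GRAPH
(staircase) restricted sum: for finitely many "rows" `i` (points `v i`, positions `ρ i ∈ ℕ`) and "columns" `j` (points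
`b j`, positions `γ j ∈ ℕ`), the set `W = {v i + b j : ρ i < γ j}` satisfies
`#vert conv W ≤ 4·(#rows + #columns)` (`ncard_extremePoints_stairPts_le`; positions injective).  A biclique cover of the
half graph has total size `Θ(n log n)`, so no union-of-Minkowski-sums argument can give this; the dyadic version is the
`log` in `…TotalsLawIntervalUnionLog`.  The linear bound is what removes that `log` (`…TotalsLawIntervalUnionLinear`):
a union of translated WINDOWS OF ONE LENGTH of a point sequence splits, block by block, into two staircase sums.

Proof (chart sweep with a record pattern; the combinatorial half is `…TotalsLawStaircasePattern`).  Fix a half-chart of weights `w_t = (σ, t)`.  If `v i + b j` is the strict top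
of `W` at `w_t` (canonically: `ρ i` minimal, then `γ j` maximal), then `i` is a ROW RECORD (`w_t·v i > w_t·v i'` for all rows
at smaller positions), `j` is a COLUMN RECORD (`w_t·b j > w_t·b j'` for all columns at larger positions), and NO record of
either kind sits at a position strictly between `ρ i` and `γ j` (`exists_patt_of_isStrictTop`).  Such "pattern pairs" of
two label sets are pairwise separated (`patt_sep`), so there are at most `#records` of them at any time, and when the label
sets change, every NEW pattern pair contains the position of a changed label (`exists_event`), injectively
(`card_sdiff_patt_le`).  Along the chart, membership of a fixed row/column in the record set is an interval of times
(`rowRec_between`), so each label enters at most once and leaves at most once: a potential argument over the finite set of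
exposing times (`card_biUnion_patt_le`) bounds the number of pattern pairs ever formed by `2·(#rows + #columns)` per
half-chart, and the two half-charts cover all vertices (`KPTT.PlanarMinkowski.mem_extremePoints_iff_charts`).
Honest label: elementary convex geometry; `IntervalUnionVertBound`, `UnionTotalsLaw C`, `TotalsLawThree C` are not touched
here; nothing in this file bears on VP ≠ VNP. [folklore]
-/

set_option linter.dupNamespace false -- `ValiantsHypothesis.ValiantsHypothesis` (summit = problem) in every name

open Finset Matrix
open scoped Pointwise

namespace Summit.ValiantsHypothesis.ValiantsHypothesis.Theorems.NewtonUnitEquationsDissociatedUniform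

namespace TotalsLaw

open Literature.Computability.AlgebraicComplexity.KPTT.PlanarMinkowski

namespace Stair

variable {ι κ : Type*} {ρ : ι → ℕ} {γ : κ → ℕ}

/-! ### Staircase sums and their chart tops -/

section Geometry

variable {R : Finset ι} {C : Finset κ} {v : ι → (Fin 2 → ℝ)} {b : κ → (Fin 2 → ℝ)}

/-- The STAIRCASE (half-graph) restricted sum `{v i + b j : i ∈ R, j ∈ C, ρ i < γ j}`. -/
noncomputable def stairPts (R : Finset ι) (C : Finset κ) (ρ : ι → ℕ) (γ : κ → ℕ) (v : ι → (Fin 2 → ℝ))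
    (b : κ → (Fin 2 → ℝ)) : Finset (Fin 2 → ℝ) :=
  ((R ×ˢ C).filter fun p => ρ p.1 < γ p.2).image fun p => v p.1 + b p.2

/-- Row records for the weight `w`: rows beating (strictly) every row at a smaller position. -/
noncomputable def rowRec (R : Finset ι) (ρ : ι → ℕ) (v : ι → (Fin 2 → ℝ)) (w : Fin 2 → ℝ) : Finset ι :=
  R.filter fun r => ∀ r' ∈ R, ρ r' < ρ r → w ⬝ᵥ v r' < w ⬝ᵥ v r

/-- Column records for the weight `w`: columns beating (strictly) every column at a larger position. -/
noncomputable def colRec (C : Finset κ) (γ : κ → ℕ) (b : κ → (Fin 2 → ℝ)) (w : Fin 2 → ℝ) : Finset κ :=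
  C.filter fun c => ∀ c' ∈ C, γ c < γ c' → w ⬝ᵥ b c' < w ⬝ᵥ b c

/-- Membership in `stairPts`. [folklore] -/
theorem mem_stairPts {x : Fin 2 → ℝ} :
    x ∈ stairPts R C ρ γ v b ↔ ∃ i ∈ R, ∃ j ∈ C, ρ i < γ j ∧ v i + b j = x := by
  classical
  simp only [stairPts, Finset.mem_image, Finset.mem_filter, Finset.mem_product, Prod.exists]
  constructor
  · rintro ⟨i, j, ⟨⟨hi, hj⟩, hlt⟩, h⟩; exact ⟨i, hi, j, hj, hlt, h⟩
  · rintro ⟨i, hi, j, hj, hlt, h⟩; exact ⟨i, j, ⟨⟨hi, hj⟩, hlt⟩, h⟩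

/-- `rowRec ⊆ R`. [folklore] -/
theorem rowRec_subset (w : Fin 2 → ℝ) : rowRec R ρ v w ⊆ R := Finset.filter_subset _ _

/-- `colRec ⊆ C`. [folklore] -/
theorem colRec_subset (w : Fin 2 → ℝ) : colRec C γ b w ⊆ C := Finset.filter_subset _ _

/-- **The record pattern of a top.** If `x` is the strict top of the staircase sum for the weight `w`, then `x = v i + b j`
for a pattern pair `(i, j)` of the two record sets (take `ρ i` minimal, then `γ j` maximal, among the representations of `x`).
[folklore] -/
theorem exists_patt_of_isStrictTop {w x : Fin 2 → ℝ} (hx : IsStrictTop w (stairPts R C ρ γ v b) x) :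
    ∃ p ∈ patt ρ γ (rowRec R ρ v w) (colRec C γ b w), v p.1 + b p.2 = x := by
  classical
  -- representations of `x`
  set S := (R ×ˢ C).filter fun p => ρ p.1 < γ p.2 ∧ v p.1 + b p.2 = x with hS
  have hSne : S.Nonempty := by
    obtain ⟨i, hi, j, hj, hlt, h⟩ := mem_stairPts.1 hx.mem
    exact ⟨(i, j), Finset.mem_filter.2 ⟨Finset.mem_product.2 ⟨hi, hj⟩, hlt, h⟩⟩
  -- minimal row position, then maximal column position
  obtain ⟨p₁, hp₁, hmin⟩ := S.exists_min_image (fun p => ρ p.1) hSne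
  set S' := S.filter fun p => p.1 = p₁.1 with hS'
  have hS'ne : S'.Nonempty := ⟨p₁, Finset.mem_filter.2 ⟨hp₁, rfl⟩⟩
  obtain ⟨p₀, hp₀, hmax⟩ := S'.exists_max_image (fun p => γ p.2) hS'ne
  have hp₀S : p₀ ∈ S := (Finset.mem_filter.1 hp₀).1
  have hp₀1 : p₀.1 = p₁.1 := (Finset.mem_filter.1 hp₀).2
  obtain ⟨hRC, hlt, hsum⟩ := Finset.mem_filter.1 hp₀S
  obtain ⟨hi, hj⟩ := Finset.mem_product.1 hRC
  -- the value of a competitor `v i' + b j'` is at most that of `x`, strictly unless it represents `x`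
  have hval : ∀ i' ∈ R, ∀ j' ∈ C, ρ i' < γ j' → w ⬝ᵥ (v i' + b j') ≤ w ⬝ᵥ (v p₀.1 + b p₀.2) := by
    intro i' hi' j' hj' h
    rw [hsum]; exact hx.le (mem_stairPts.2 ⟨i', hi', j', hj', h, rfl⟩)
  have hval' : ∀ i' ∈ R, ∀ j' ∈ C, ρ i' < γ j' → v i' + b j' ≠ x →
      w ⬝ᵥ (v i' + b j') < w ⬝ᵥ (v p₀.1 + b p₀.2) := by
    intro i' hi' j' hj' h hne
    rw [hsum]; exact hx.lt (mem_stairPts.2 ⟨i', hi', j', hj', h, rfl⟩) hne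
  refine ⟨p₀, mem_patt.2 ⟨?_, ?_, hlt, ?_, ?_⟩, hsum⟩
  · -- row record
    refine Finset.mem_filter.2 ⟨hi, fun r' hr' hlt' => ?_⟩
    have hne : v r' + b p₀.2 ≠ x := by
      intro h
      have hmem : (r', p₀.2) ∈ S :=
        Finset.mem_filter.2 ⟨Finset.mem_product.2 ⟨hr', hj⟩, hlt'.trans hlt, h⟩
      have := hmin _ hmem
      rw [← hp₀1] at this; simp only at this; omega
    have := hval' r' hr' p₀.2 hj (hlt'.trans hlt) hne
    rw [dotProduct_add, dotProduct_add] at this; linarith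
  · -- column record
    refine Finset.mem_filter.2 ⟨hj, fun c' hc' hlt' => ?_⟩
    have hne : v p₀.1 + b c' ≠ x := by
      intro h
      have hmem : (p₀.1, c') ∈ S' := Finset.mem_filter.2
        ⟨Finset.mem_filter.2 ⟨Finset.mem_product.2 ⟨hi, hc'⟩, hlt.trans hlt', h⟩, hp₀1⟩
      have := hmax _ hmem
      simp only at this; omega
    have := hval' p₀.1 hi c' hc' (hlt.trans hlt') hne
    rw [dotProduct_add, dotProduct_add] at this; linarith
  · -- no row record strictly between
    rintro k hk ⟨hk1, hk2⟩
    obtain ⟨hkR, hkrec⟩ := Finset.mem_filter.1 hk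
    have h1 := hkrec p₀.1 hi hk1
    have h2 := hval k hkR p₀.2 hj hk2
    rw [dotProduct_add, dotProduct_add] at h2; linarith
  · -- no column record strictly between
    rintro k hk ⟨hk1, hk2⟩
    obtain ⟨hkC, hkrec⟩ := Finset.mem_filter.1 hk
    have h1 := hkrec p₀.2 hj hk2
    have h2 := hval p₀.1 hi k hkC hk1
    rw [dotProduct_add, dotProduct_add] at h2; linarith

/-- The pairing of a chart weight with a point. [folklore] -/
private theorem chart_dot (σ t : ℝ) (x : Fin 2 → ℝ) : ![σ, t] ⬝ᵥ x = σ * x 0 + t * x 1 := by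
  simp [dotProduct, Fin.sum_univ_two]

/-- Strict affine inequalities in the chart parameter hold on an interval of parameters. [folklore] -/
private theorem between {σ t₁ t₂ t₃ : ℝ} {y z : Fin 2 → ℝ} (h₁ : ![σ, t₁] ⬝ᵥ y < ![σ, t₁] ⬝ᵥ z)
    (h₃ : ![σ, t₃] ⬝ᵥ y < ![σ, t₃] ⬝ᵥ z) (h12 : t₁ ≤ t₂) (h23 : t₂ ≤ t₃) :
    ![σ, t₂] ⬝ᵥ y < ![σ, t₂] ⬝ᵥ z := by
  simp only [chart_dot] at h₁ h₃ ⊢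
  by_cases hd : y 1 ≤ z 1
  · nlinarith
  · nlinarith

/-- Row records form intervals in the chart parameter. [folklore] -/
theorem rowRec_between (σ : ℝ) (k : ι) (t₁ t₂ t₃ : ℝ) (h12 : t₁ ≤ t₂) (h23 : t₂ ≤ t₃)
    (h₁ : k ∈ rowRec R ρ v ![σ, t₁]) (h₃ : k ∈ rowRec R ρ v ![σ, t₃]) : k ∈ rowRec R ρ v ![σ, t₂] := by
  obtain ⟨hk, h₁⟩ := Finset.mem_filter.1 h₁
  obtain ⟨-, h₃⟩ := Finset.mem_filter.1 h₃
  exact Finset.mem_filter.2 ⟨hk, fun r' hr' h => between (h₁ r' hr' h) (h₃ r' hr' h) h12 h23⟩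

/-- Column records form intervals in the chart parameter. [folklore] -/
theorem colRec_between (σ : ℝ) (k : κ) (t₁ t₂ t₃ : ℝ) (h12 : t₁ ≤ t₂) (h23 : t₂ ≤ t₃)
    (h₁ : k ∈ colRec C γ b ![σ, t₁]) (h₃ : k ∈ colRec C γ b ![σ, t₃]) : k ∈ colRec C γ b ![σ, t₂] := by
  obtain ⟨hk, h₁⟩ := Finset.mem_filter.1 h₁
  obtain ⟨-, h₃⟩ := Finset.mem_filter.1 h₃
  exact Finset.mem_filter.2 ⟨hk, fun c' hc' h => between (h₁ c' hc' h) (h₃ c' hc' h) h12 h23⟩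

open Classical in
/-- **Chart count.** Along one half-chart `(σ, t)`, the staircase sum has at most `2·(#R + #C)` chart tops. [folklore] -/
theorem card_chartTops_le (hρ : Function.Injective ρ) (hγ : Function.Injective γ) (σ : ℝ) :
    ((stairPts R C ρ γ v b).filter fun x => ∃ t : ℝ, IsStrictTop ![σ, t] (stairPts R C ρ γ v b) x).card ≤
      2 * (R.card + C.card) := by
  classical
  set W := stairPts R C ρ γ v b with hW
  set RS := W.filter fun x => ∃ t : ℝ, IsStrictTop ![σ, t] W x with hRS
  rcases RS.eq_empty_or_nonempty with hRSe | ⟨x₀, hx₀⟩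
  · rw [hRSe]; simp
  -- an exposing time and a pattern pair for every chart top
  have hτ : ∀ x ∈ RS, ∃ t : ℝ, ∃ p ∈ patt ρ γ (rowRec R ρ v ![σ, t]) (colRec C γ b ![σ, t]),
      v p.1 + b p.2 = x := by
    intro x hx
    obtain ⟨t, ht⟩ := (Finset.mem_filter.1 hx).2
    exact ⟨t, exists_patt_of_isStrictTop ht⟩
  haveI : Nonempty (ι × κ) := by
    obtain ⟨t, p, -, -⟩ := hτ x₀ hx₀
    exact ⟨p⟩
  choose! τ π hπ hπx using hτ
  set T := RS.image τ with hT
  calc RS.card = (RS.image π).card := by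
        refine (Finset.card_image_of_injOn fun x hx x' hx' h => ?_).symm
        rw [← hπx x (Finset.mem_coe.1 hx), ← hπx x' (Finset.mem_coe.1 hx'), h]
    _ ≤ (T.biUnion fun t => patt ρ γ (rowRec R ρ v ![σ, t]) (colRec C γ b ![σ, t])).card := by
        refine Finset.card_le_card fun p hp => ?_
        obtain ⟨x, hx, rfl⟩ := Finset.mem_image.1 hp
        exact Finset.mem_biUnion.2 ⟨τ x, Finset.mem_image_of_mem τ hx, hπ x hx⟩
    _ ≤ 2 * (R.card + C.card) :=
        card_biUnion_patt_le hρ hγ (𝒜 := fun t => rowRec R ρ v ![σ, t]) (ℬ := fun t => colRec C γ b ![σ, t])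
          (fun t => rowRec_subset _) (fun t => colRec_subset _)
          (fun k t₁ t₂ t₃ h12 h23 h₁ h₃ => rowRec_between σ k t₁ t₂ t₃ h12 h23 h₁ h₃)
          (fun k t₁ t₂ t₃ h12 h23 h₁ h₃ => colRec_between σ k t₁ t₂ t₃ h12 h23 h₁ h₃) T

/-- **THE STAIRCASE HULL BOUND.** For rows `i ∈ R` (points `v i`, injective positions `ρ i`) and columns `j ∈ C` (points
`b j`, injective positions `γ j`), the half-graph restricted sum `{v i + b j : ρ i < γ j}` has at most `4·(#R + #C)` hull
vertices. [folklore] -/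
theorem ncard_extremePoints_stairPts_le (hρ : Function.Injective ρ) (hγ : Function.Injective γ) :
    ((convexHull ℝ (stairPts R C ρ γ v b : Set (Fin 2 → ℝ))).extremePoints ℝ).ncard ≤ 4 * (R.card + C.card) := by
  classical
  have h1 := card_chartTops_le (R := R) (C := C) (v := v) (b := b) hρ hγ 1
  have h2 := card_chartTops_le (R := R) (C := C) (v := v) (b := b) hρ hγ (-1)
  have hV : (convexHull ℝ (stairPts R C ρ γ v b : Set (Fin 2 → ℝ))).extremePoints ℝ =
      ↑(((stairPts R C ρ γ v b).filter fun x => ∃ t : ℝ, IsStrictTop ![1, t] (stairPts R C ρ γ v b) x) ∪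
        ((stairPts R C ρ γ v b).filter fun x => ∃ t : ℝ, IsStrictTop ![-1, t] (stairPts R C ρ γ v b) x)) := by
    ext x
    rw [Finset.coe_union, Finset.coe_filter, Finset.coe_filter, mem_extremePoints_iff_charts]
    constructor
    · rintro (⟨t, ht⟩ | ⟨t, ht⟩)
      · exact Or.inl ⟨ht.1, t, ht⟩
      · exact Or.inr ⟨ht.1, t, ht⟩
    · rintro (⟨-, h⟩ | ⟨-, h⟩)
      · exact Or.inl h
      · exact Or.inr h
  rw [hV, Set.ncard_coe_finset]
  refine (Finset.card_union_le _ _).trans ?_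
  omega

end Geometry

/-! ### The diagonal staircase `{v i + b j : i ≤ j < n}` -/

/-- The diagonal staircase sum `{v i + b j : i ≤ j < n}` of two point sequences. -/
noncomputable def diagPts (n : ℕ) (v b : ℕ → (Fin 2 → ℝ)) : Finset (Fin 2 → ℝ) :=
  ((Finset.range n ×ˢ Finset.range n).filter fun p => p.1 ≤ p.2).image fun p => v p.1 + b p.2

/-- The diagonal staircase is the staircase with row positions `2i` and column positions `2j + 1`. [folklore] -/
theorem diagPts_eq (n : ℕ) (v b : ℕ → (Fin 2 → ℝ)) :
    diagPts n v b = stairPts (Finset.range n) (Finset.range n) (fun i => 2 * i) (fun j => 2 * j + 1) v b := by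
  classical
  ext x
  rw [mem_stairPts]
  simp only [diagPts, Finset.mem_image, Finset.mem_filter, Finset.mem_product, Prod.exists]
  constructor
  · rintro ⟨i, j, ⟨⟨hi, hj⟩, hle⟩, h⟩; exact ⟨i, hi, j, hj, by omega, h⟩
  · rintro ⟨i, hi, j, hj, hlt, h⟩; exact ⟨i, j, ⟨⟨hi, hj⟩, by omega⟩, h⟩

/-- **`#vert conv {v i + b j : i ≤ j < n} ≤ 8n`** for arbitrary planar point sequences `v, b`. [folklore] -/
theorem ncard_extremePoints_diagPts_le (n : ℕ) (v b : ℕ → (Fin 2 → ℝ)) :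
    ((convexHull ℝ (diagPts n v b : Set (Fin 2 → ℝ))).extremePoints ℝ).ncard ≤ 8 * n := by
  rw [diagPts_eq]
  refine (ncard_extremePoints_stairPts_le (fun i j h => by simpa using h) (fun i j h => by simpa using h)).trans ?_
  rw [Finset.card_range]; omega

end Stair

end TotalsLaw

end Summit.ValiantsHypothesis.ValiantsHypothesis.Theorems.NewtonUnitEquationsDissociatedUniform
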